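import Mathlib
import Summits.Ventures.PercRepro2.Defs
import Summits.Ventures.PercRepro2.Harris
import Summits.Ventures.PercRepro2.Graph
import Summits.Ventures.PercRepro2.Events

/-!
# The graphs `K_{2,k}` and their root cluster (blind cell PercRepro2, mine-a g51)

`K_{2,k}`: root `r = 0`, hit vertex `h = 1`, middle vertices `x_i = mid i = i + 2` (`i < k`), the
lower edge `lo i = 2i` joining `r` and `x_i`, the upper edge `up i = 2i + 1` joining `x_i` and `h`
(`ends k`).  The root cluster is explicit (`cluster_eq`, generalising `KTwoFiveNegative` from `k = 5`
to every `k`): `h ∈ C_r` iff some path is fully open (`Hit`, `one_mem_iff`), and `x_i ∈ C_r` iff its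
lower edge is open, or `Hit` and its upper edge is open (`mid_mem_iff`).  `KTwoKEvents` builds the
three events of the lane's inequality at a principal pair on top of this, `KTwoKRefutation` refutes
`(T_h)` on `K_{2,21}` at the uniform weight `1/2`.  No instance, no notation.
-/

namespace Summit.Ventures.PercRepro2

namespace KTwoK

open Finset

section Graph

variable {k : ℕ}

/-- The lower edge of the middle vertex `i`: joins the root and `x_i`. -/
def lo (i : Fin k) : Fin (2 * k) := ⟨2 * i.val, by omega⟩

/-- The upper edge of the middle vertex `i`: joins `x_i` and the hit vertex. -/
def up (i : Fin k) : Fin (2 * k) := ⟨2 * i.val + 1, by omega⟩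

/-- The middle vertex `x_i = i + 2`. -/
def mid (i : Fin k) : Fin (k + 2) := ⟨i.val + 2, by omega⟩

/-- The edge map of `K_{2,k}`. -/
def ends (k : ℕ) : Fin (2 * k) → Sym2 (Fin (k + 2)) := fun e =>
  if e.val % 2 = 0 then s((0 : Fin (k + 2)), ⟨e.val / 2 + 2, by omega⟩)
  else s((⟨e.val / 2 + 2, by omega⟩ : Fin (k + 2)), 1)

/-- `ends` at a lower edge. -/
lemma ends_lo (i : Fin k) : ends k (lo i) = s(0, mid i) := by
  have h1 : (lo i).val % 2 = 0 := by simp [lo]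
  have h2 : (⟨(lo i).val / 2 + 2, by omega⟩ : Fin (k + 2)) = mid i := by
    apply Fin.ext
    simp only [lo, mid]
    omega
  simp only [ends, h1, if_true, h2]

/-- `ends` at an upper edge. -/
lemma ends_up (i : Fin k) : ends k (up i) = s(mid i, 1) := by
  have h1 : ¬ ((up i).val % 2 = 0) := by simp [up]
  have h2 : (⟨(up i).val / 2 + 2, by omega⟩ : Fin (k + 2)) = mid i := by
    apply Fin.ext
    simp only [up, mid]
    omega
  simp only [ends, h1, if_false, h2]

/-- Every edge is a lower or an upper edge of some middle vertex. -/
lemma edge_cases (e : Fin (2 * k)) : (∃ i, e = lo i) ∨ (∃ i, e = up i) := by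
  by_cases h : e.val % 2 = 0
  · left
    refine ⟨⟨e.val / 2, by omega⟩, ?_⟩
    ext; simp only [lo]; omega
  · right
    refine ⟨⟨e.val / 2, by omega⟩, ?_⟩
    ext; simp only [up]; omega

/-- The middle vertices are not the root. -/
lemma mid_ne_zero (i : Fin k) : mid i ≠ 0 := by
  intro h
  have := congrArg Fin.val h
  simp [mid] at this

/-- The middle vertices are not the hit vertex. -/
lemma mid_ne_one (i : Fin k) : mid i ≠ 1 := by
  intro h
  have := congrArg Fin.val h
  simp [mid] at this

/-- `mid` is injective. -/
lemma mid_injective : Function.Injective (mid : Fin k → Fin (k + 2)) := by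
  intro i j h
  have := congrArg Fin.val h
  change i.val + 2 = j.val + 2 at this
  exact Fin.ext (by omega)

/-- `lo` is injective. -/
lemma lo_injective : Function.Injective (lo : Fin k → Fin (2 * k)) := by
  intro i j h
  have := congrArg Fin.val h
  change 2 * i.val = 2 * j.val at this
  exact Fin.ext (by omega)

/-- `up` is injective. -/
lemma up_injective : Function.Injective (up : Fin k → Fin (2 * k)) := by
  intro i j h
  have := congrArg Fin.val h
  change 2 * i.val + 1 = 2 * j.val + 1 at this
  exact Fin.ext (by omega)

/-- A lower edge is never an upper edge. -/
lemma lo_ne_up (i j : Fin k) : lo i ≠ up j := by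
  intro h
  have := congrArg Fin.val h
  change 2 * i.val = 2 * j.val + 1 at this
  omega

/-- The root is not the hit vertex. -/
lemma zero_ne_one' : (0 : Fin (k + 2)) ≠ 1 := by
  intro h
  have := congrArg Fin.val h
  simp at this

end Graph

section Cluster

variable {k : ℕ}

/-- Some path is fully open. -/
def Hit (ω : Config (Fin (2 * k))) : Prop := ∃ i : Fin k, ω (lo i) = true ∧ ω (up i) = true

/-- The explicit cluster of the root: the root, the middle vertices with an open lower edge, and —
under `Hit` — the hit vertex and the middle vertices with an open upper edge. -/
def clusterSet (ω : Config (Fin (2 * k))) : Set (Fin (k + 2)) :=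
  {v | v = 0 ∨ (∃ i, v = mid i ∧ (ω (lo i) = true ∨ (Hit ω ∧ ω (up i) = true))) ∨ (v = 1 ∧ Hit ω)}

/-- The explicit set is closed under open adjacency. -/
lemma clusterSet_closed (ω : Config (Fin (2 * k))) :
    ∀ x ∈ clusterSet ω, ∀ y, (openGraph (ends k) ω).Adj x y → y ∈ clusterSet ω := by
  intro x hx y hxy
  obtain ⟨-, e, he, hends⟩ := openGraph_adj.1 hxy
  rcases edge_cases e with ⟨i, rfl⟩ | ⟨i, rfl⟩
  · rw [ends_lo] at hends
    rcases Sym2.eq_iff.1 hends with ⟨rfl, rfl⟩ | ⟨rfl, rfl⟩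
    · exact Or.inr (Or.inl ⟨i, rfl, Or.inl he⟩)
    · exact Or.inl rfl
  · rw [ends_up] at hends
    rcases Sym2.eq_iff.1 hends with ⟨rfl, rfl⟩ | ⟨rfl, rfl⟩
    · rcases hx with h0 | ⟨j, hj, hj'⟩ | ⟨h1, _⟩
      · exact absurd h0 (mid_ne_zero i)
      · have hij : j = i := mid_injective hj.symm
        subst hij
        rcases hj' with hlo | ⟨hhit, _⟩
        · exact Or.inr (Or.inr ⟨rfl, ⟨j, hlo, he⟩⟩)
        · exact Or.inr (Or.inr ⟨rfl, hhit⟩)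
      · exact absurd h1 (mid_ne_one i)
    · rcases hx with h0 | ⟨j, hj, -⟩ | ⟨-, hhit⟩
      · exact absurd h0.symm zero_ne_one'
      · exact absurd hj.symm (mid_ne_one j)
      · exact Or.inr (Or.inl ⟨i, rfl, Or.inr ⟨hhit, he⟩⟩)

/-- Open adjacency along a lower edge. -/
lemma openAdj_lo {ω : Config (Fin (2 * k))} {i : Fin k} (h : ω (lo i) = true) :
    OpenAdj (ends k) ω 0 (mid i) := ⟨lo i, h, ends_lo i⟩

/-- Open adjacency along an upper edge. -/
lemma openAdj_up {ω : Config (Fin (2 * k))} {i : Fin k} (h : ω (up i) = true) :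
    OpenAdj (ends k) ω (mid i) 1 := ⟨up i, h, ends_up i⟩

/-- Under `Hit`, the hit vertex is connected to the root. -/
lemma conn_one_of_hit {ω : Config (Fin (2 * k))} (h : Hit ω) : Conn (ends k) ω 0 1 := by
  obtain ⟨i, hlo, hup⟩ := h
  exact conn_trans (conn_of_openAdj (openAdj_lo hlo)) (conn_of_openAdj (openAdj_up hup))

/-- **The cluster of the root of `K_{2,k}`** is the explicit set. -/
theorem cluster_eq (ω : Config (Fin (2 * k))) : cluster (ends k) ω 0 = clusterSet ω := by
  apply Set.Subset.antisymm
  · intro v hv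
    exact mem_of_conn_of_closed (clusterSet_closed ω) (Or.inl rfl) hv
  · intro v hv
    rcases hv with rfl | ⟨i, rfl, hlo | ⟨hhit, hup⟩⟩ | ⟨rfl, hhit⟩
    · exact mem_cluster_self (ends k) ω 0
    · exact conn_of_openAdj (openAdj_lo hlo)
    · exact conn_trans (conn_one_of_hit hhit) (conn_symm (conn_of_openAdj (openAdj_up hup)))
    · exact conn_one_of_hit hhit

/-- Membership of the hit vertex in the cluster. -/
lemma one_mem_iff (ω : Config (Fin (2 * k))) : (1 : Fin (k + 2)) ∈ cluster (ends k) ω 0 ↔ Hit ω := by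
  rw [cluster_eq]
  constructor
  · rintro (h | ⟨i, hi, -⟩ | ⟨-, h⟩)
    · exact absurd h.symm zero_ne_one'
    · exact absurd hi.symm (mid_ne_one i)
    · exact h
  · intro h
    exact Or.inr (Or.inr ⟨rfl, h⟩)

/-- Membership of a middle vertex in the cluster. -/
lemma mid_mem_iff (ω : Config (Fin (2 * k))) (i : Fin k) :
    mid i ∈ cluster (ends k) ω 0 ↔ ω (lo i) = true ∨ (Hit ω ∧ ω (up i) = true) := by
  rw [cluster_eq]
  constructor
  · rintro (h | ⟨j, hj, hj'⟩ | ⟨h, -⟩)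
    · exact absurd h (mid_ne_zero i)
    · have : j = i := mid_injective hj.symm
      subst this
      exact hj'
    · exact absurd h (mid_ne_one i)
  · intro h
    exact Or.inr (Or.inl ⟨i, rfl, h⟩)

end Cluster

end KTwoK

end Summit.Ventures.PercRepro2
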